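import Summits.Ventures.Crystal3D.Theorems.StickyWulffConstantNoReconstructionGainConfinedCertificateThin
import Literature.Geometry.DiscreteGeometry.KerteszNinePointsHemisphere
import HarnessLib

/-!
# No `(111)` criminal among TWO-LEVEL films (stacking-disordered bilayers at the ideal heights)
# (crux `NoReconstructionGain`, stmt-Ventures-19144, line `replication-exactness`, inside `stub_noCriminal`)

HONEST FRAMING. Part of the venture `Summits/Ventures/Crystal3D` (cell `crystal3d-full`), helper `--supports` the
crux `NoReconstructionGain` (stmt-Ventures-19144, route `route-Ventures-StickyWulffConstant`), lead wulff-p1 g24.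
A new CONFINED CLASS of `(111)` films shown free of criminals by the pointwise ("weighted kissing") method; the crux
proper (unconfined films) is not moved.

`c = √(2/3)`.  A TWO-LEVEL film over the close-packed layer `k` of `Λ₀` (`kc ≤ s < (k+1)c`) is a film all of whose
balls lie at the two ideal layer heights `(k+1)c` and `(k+2)c`; laterally they are arbitrary (so: first-layer balls
in fcc OR hcp hollows ball by ball, second-layer balls in hollows of unit triangles of first-layer balls — in-plane
stacking disorder, partial-dislocation domain walls inside the adlayers, isolated registered dimers/trimers, …).  The
earlier classes do not contain it: `not_isCriminal_basal_of_height_le_half` needs every ball below `(k+1)c + 1/2`,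
`not_isCriminal_basal_of_low_offLattice` needs every OFF-LATTICE ball below `(k+1)c + 1/4`, whereas here off-lattice
balls sit at `(k+2)c`.

* `not_isCriminal_basal_of_rows` — the REDUCTION of `…ConfinedCertificateThin`, re-cut ball by ball: instead of one
  windowed bound for all offsets it asks, for each ball `q`, the weighted-kissing row for codes whose members are
  plug directions (`u₂ = kc − q₂`) or directions to actual partners (`u₂ = x₂ − q₂`, `x ∈ Q`).  Same proof
  (fractional orientation `y = g/2`, `not_isCriminal_of_fracOrientation`).
* `levelRow_ramp` — the row for codes on the levels `{−2c, −c, 0, c}` under the clipped linear ramp: members at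
  `−c` are at most three (`card_mul_sq_le_of_sameHeight`) and weigh `2`, members at `0` are at most six (Musin's
  band lemma `card_band_le_six`) and weigh `1`, members at `c` weigh `0`, `−2c` is impossible: total `≤ 12`.
* **`not_isCriminal_basal_twoLevel`** — no two-level film over layer `k` is a criminal.

WHAT THIS IS NOT: nothing about films with a ball at an intermediate height (the open part of the `W = c` window,
cell memo HOLLOW-g24 §2b); rung F-C1 not moved.
-/

noncomputable section

namespace Summit.Ventures.Crystal3D.Theorems

open Summit.Ventures.Crystal3D Finset
open Literature.MathematicalPhysics.StatisticalMechanics (fccStacking contactDeficiency barlowPos barlowPos_mem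
  barlowPos_apply_two constHagg isHaggSeq_const le_dist_of_mem_barlowStacking_ideal)
open scoped InnerProductSpace

/-! ## The reduction, ball by ball -/

/-- **Reduction with ball-indexed rows.**  Over the close-packed layer `k` (`kc ≤ s < (k+1)c`, `c = √(2/3)`), let
`g` satisfy `g z + g (−z) = 2` and `g = 2` on `z ≤ −c`.  If for every ball `q ∈ Q` and every finite `60°`-code `N`
whose members have third coordinate `kc − q₂` (the plug directions of `q`) or `x₂ − q₂` for some `x ∈ Q` (the
directions to film partners), `Σ_{u∈N} g(u₂) ≤ 12`, then `Q` is not a criminal on `H(e₃, s)`. -/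
theorem not_isCriminal_basal_of_rows (k : ℤ) {s : ℝ} (hs : (k : ℝ) * Real.sqrt (2 / 3) ≤ s)
    (hs' : s < ((k : ℝ) + 1) * Real.sqrt (2 / 3)) {g : ℝ → ℝ} (hsym : ∀ z, g z + g (-z) = 2)
    (hplug : ∀ z, z ≤ -Real.sqrt (2 / 3) → g z = 2) {Q : Finset (EuclideanSpace ℝ (Fin 3))}
    (hrow : ∀ q ∈ Q, ∀ N : Finset (EuclideanSpace ℝ (Fin 3)), (∀ u ∈ N, ‖u‖ = 1) →
      (∀ u ∈ N, ∀ v ∈ N, u ≠ v → ⟪u, v⟫_ℝ ≤ 1 / 2) →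
      (∀ u ∈ N, u 2 = (k : ℝ) * Real.sqrt (2 / 3) - q 2 ∨ ∃ x ∈ Q, u 2 = x 2 - q 2) →
      ∑ u ∈ N, g (u 2) ≤ 12) :
    ¬ IsCriminal (EuclideanSpace.single 2 (1 : ℝ)) s Q := by
  classical
  intro hcrim
  have hQ : IsFilmOn (EuclideanSpace.single 2 (1 : ℝ)) s Q := hcrim.1
  set ν : EuclideanSpace ℝ (Fin 3) := EuclideanSpace.single 2 (1 : ℝ) with hν
  set c : ℝ := Real.sqrt (2 / 3) with hc
  have h23 : Real.sqrt (2 / 3) ^ 2 = 2 / 3 * (1 : ℝ) ^ 2 := by rw [Real.sq_sqrt (by norm_num)]; norm_num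
  refine not_isCriminal_of_fracOrientation (ν := ν) (s := s) (fun x q => g ((x - q) 2) / 2)
    (fun q _ q' _ _ => ?_) (fun q hq => ?_) hcrim
  · have : (q - q') 2 = -((q' - q) 2) := by simp [PiLp.sub_apply]
    rw [this]; linarith [hsym ((q' - q) 2)]
  · set P : Finset (EuclideanSpace ℝ (Fin 3)) := (plugSet_finite ν s q).toFinset with hP
    set F : Finset (EuclideanSpace ℝ (Fin 3)) := Q.filter (fun q' => dist q q' = 1) with hF
    have hPmem : ∀ p, p ∈ P ↔ p ∈ plugSet ν s q := fun p => by rw [hP, Set.Finite.mem_toFinset]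
    have hFmem : ∀ x, x ∈ F ↔ x ∈ Q ∧ dist q x = 1 := fun x => by rw [hF, Finset.mem_filter]
    have hdist1 : ∀ x ∈ F ∪ P, dist q x = 1 := by
      intro x hx
      rcases Finset.mem_union.1 hx with hx | hx
      · exact ((hFmem x).1 hx).2
      · exact ((hPmem x).1 hx).2
    have hsep : ∀ x ∈ F ∪ P, ∀ x' ∈ F ∪ P, x ≠ x' → 1 ≤ dist x x' := by
      intro x hx x' hx' hne
      rcases Finset.mem_union.1 hx with hx | hx <;> rcases Finset.mem_union.1 hx' with hx' | hx'
      · exact hQ.1 x ((hFmem x).1 hx).1 x' ((hFmem x').1 hx').1 hne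
      · exact hQ.2 x ((hFmem x).1 hx).1 x' ((hPmem x').1 hx').1
      · rw [dist_comm]; exact hQ.2 x' ((hFmem x').1 hx').1 x ((hPmem x).1 hx).1
      · exact le_dist_of_mem_barlowStacking_ideal isHaggSeq_const one_pos h23 ((hPmem x).1 hx).1.1
          ((hPmem x').1 hx').1.1 hne
    have hdisj : Disjoint F P := by
      rw [Finset.disjoint_left]
      intro x hxF hxP
      have h := hQ.2 x ((hFmem x).1 hxF).1 x ((hPmem x).1 hxP).1
      rw [dist_self] at h
      exact absurd h (by norm_num)
    set N : Finset (EuclideanSpace ℝ (Fin 3)) := (F ∪ P).image (fun x => x - q) with hN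
    have hinj : Set.InjOn (fun x => x - q) ↑(F ∪ P) := fun x _ x' _ h => sub_left_injective h
    have hN1 : ∀ u ∈ N, ‖u‖ = 1 := by
      intro u hu
      obtain ⟨x, hx, rfl⟩ := Finset.mem_image.1 hu
      rw [← dist_eq_norm, dist_comm]; exact hdist1 x hx
    have hN2 : ∀ u ∈ N, ∀ v ∈ N, u ≠ v → ⟪u, v⟫_ℝ ≤ 1 / 2 := by
      intro u hu v hv huv
      obtain ⟨x, hx, rfl⟩ := Finset.mem_image.1 hu
      obtain ⟨x', hx', rfl⟩ := Finset.mem_image.1 hv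
      have hne : x ≠ x' := fun h => huv (by rw [h])
      exact real_inner_sub_le_half_of_dist (hdist1 x hx) (hdist1 x' hx') (hsep x hx x' hx' hne)
    have hN3 : ∀ u ∈ N, u 2 = (k : ℝ) * Real.sqrt (2 / 3) - q 2 ∨ ∃ x ∈ Q, u 2 = x 2 - q 2 := by
      intro u hu
      obtain ⟨x, hx, rfl⟩ := Finset.mem_image.1 hu
      rw [PiLp.sub_apply]
      rcases Finset.mem_union.1 hx with hx | hx
      · exact Or.inr ⟨x, ((hFmem x).1 hx).1, rfl⟩
      · left
        rw [plug_apply_two_eq_basal k hs hs' hQ hq ((hPmem x).1 hx)]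
    have hbound := hrow q hq N hN1 hN2 hN3
    rw [hN, Finset.sum_image hinj, Finset.sum_union hdisj] at hbound
    have hPsum : ∑ x ∈ P, g ((x - q) 2) = 2 * (P.card : ℝ) := by
      rw [Finset.sum_congr rfl fun x hx => ?_, Finset.sum_const, nsmul_eq_mul, mul_comm]
      rw [PiLp.sub_apply, plug_apply_two_eq_basal k hs hs' hQ hq ((hPmem x).1 hx)]
      apply hplug
      have := le_height_of_isFilmOn_basal k hs hQ hq
      linarith
    have hcard : ((plugSet ν s q).ncard : ℝ) = P.card := by
      rw [hP, Set.ncard_eq_toFinset_card _ (plugSet_finite ν s q)]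
    rw [hPsum] at hbound
    rw [hcard, ← Finset.sum_div]
    have : ∑ x ∈ F, g ((x - q) 2) = ∑ i ∈ F, g ((i - q) 2) := rfl
    linarith

/-! ## The row on the four levels `{−2c, −c, 0, c}` -/

/-- The third coordinate is the `e₃`-height (local copy). -/
private theorem inner_e3_lvl (v : EuclideanSpace ℝ (Fin 3)) :
    ⟪EuclideanSpace.single 2 (1 : ℝ), v⟫_ℝ = v 2 := by
  rw [real_inner_comm, EuclideanSpace.inner_single_right]; simp

/-- **The level row.**  A finite `60°`-code whose members have third coordinate in `{−2√(2/3), −√(2/3), 0, √(2/3)}`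
has clipped-linear-ramp weight `Σ min 2 (max 0 (1 − u₂/√(2/3))) ≤ 12`: the level `−2√(2/3) < −1` is empty, the level
`−√(2/3)` holds at most three members (weight `2`), the equator at most six (weight `1`), the level `√(2/3)` weighs `0`.
-/
theorem levelRow_ramp (N : Finset (EuclideanSpace ℝ (Fin 3))) (h1 : ∀ u ∈ N, ‖u‖ = 1)
    (h2 : ∀ u ∈ N, ∀ v ∈ N, u ≠ v → ⟪u, v⟫_ℝ ≤ 1 / 2)
    (hlev : ∀ u ∈ N, u 2 = -(2 * Real.sqrt (2 / 3)) ∨ u 2 = -Real.sqrt (2 / 3) ∨ u 2 = 0 ∨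
      u 2 = Real.sqrt (2 / 3)) :
    ∑ u ∈ N, min 2 (max 0 (1 - u 2 / Real.sqrt (2 / 3))) ≤ 12 := by
  classical
  set c : ℝ := Real.sqrt (2 / 3) with hc
  have hc2 : c ^ 2 = 2 / 3 := Real.sq_sqrt (by norm_num)
  have hcpos : 0 < c := Real.sqrt_pos.2 (by norm_num)
  have hc1 : 1 < 2 * c := by nlinarith
  -- no member at `−2c`
  have hlev' : ∀ u ∈ N, u 2 = -c ∨ u 2 = 0 ∨ u 2 = c := by
    intro u hu
    rcases hlev u hu with h | h
    · exfalso
      have habs : |u 2| ≤ 1 := by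
        have := abs_real_inner_le_norm (EuclideanSpace.single 2 (1 : ℝ)) u
        rw [inner_e3_lvl, PiLp.norm_single, norm_one, one_mul, h1 u hu] at this
        exact this
      rw [h, abs_le] at habs
      linarith [habs.1]
    · exact h
  set D := N.filter (fun u => u 2 = -c) with hD
  set E := N.filter (fun u => u 2 = 0) with hE
  set U := N.filter (fun u => u 2 = c) with hU
  -- weights on the three levels
  have hw : ∀ u ∈ N, min 2 (max 0 (1 - u 2 / c)) =
      (if u 2 = -c then 2 else 0) + (if u 2 = 0 then 1 else 0) := by
    intro u hu
    rcases hlev' u hu with h | h | h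
    · rw [h, if_pos rfl, if_neg (by linarith), neg_div, div_self hcpos.ne']; norm_num
    · rw [h, if_neg (by linarith), if_pos rfl]; norm_num
    · rw [h, if_neg (by linarith), if_neg (by linarith), div_self hcpos.ne']; norm_num
  rw [Finset.sum_congr rfl hw, sum_add_distrib, ← Finset.sum_filter, ← Finset.sum_filter, sum_const, sum_const,
    nsmul_eq_mul, nsmul_eq_mul, mul_one]
  -- at most three at depth `c`
  have hD3 : ((N.filter fun u => u 2 = -c).card : ℝ) ≤ 3 := by
    have h := card_mul_sq_le_of_sameHeight (N.filter fun u => u 2 = -c) (-c)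
      (fun u hu => h1 u (mem_filter.1 hu).1)
      (fun u hu v hv huv => h2 u (mem_filter.1 hu).1 v (mem_filter.1 hv).1 huv)
      (fun u hu => (mem_filter.1 hu).2)
    rw [neg_sq, hc2] at h
    linarith
  -- at most six on the equator (Musin)
  have hE6 : (N.filter fun u => u 2 = 0).card ≤ 6 := by
    have hen : ‖(EuclideanSpace.single 2 (1 : ℝ) : EuclideanSpace ℝ (Fin 3))‖ = 1 := by
      rw [PiLp.norm_single, norm_one]
    refine Literature.Geometry.DiscreteGeometry.card_band_le_six hen (fun u hu => h1 u (mem_filter.1 hu).1)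
      (fun u hu => ?_) (fun u hu => ?_)
      (fun u hu w hw huw => h2 u (mem_filter.1 hu).1 w (mem_filter.1 hw).1 huw)
    · rw [inner_e3_lvl, (mem_filter.1 hu).2]
    · rw [inner_e3_lvl, (mem_filter.1 hu).2]; norm_num
  have hE6' : ((N.filter fun u => u 2 = 0).card : ℝ) ≤ 6 := by exact_mod_cast hE6
  linarith

/-! ## Two-level films -/

/-- **No `(111)` criminal among two-level films.**  Over the close-packed layer `k` of `Λ₀`
(`k√(2/3) ≤ s < (k+1)√(2/3)`), a film all of whose balls lie at height `(k+1)√(2/3)` or `(k+2)√(2/3)` — lateral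
positions arbitrary — is not a criminal: at every ball the directions to plugs and partners lie on the levels
`{−2c, −c, 0, c}` relative to it, and the level row `levelRow_ramp` is the certificate. -/
theorem not_isCriminal_basal_twoLevel (k : ℤ) {s : ℝ} (hs : (k : ℝ) * Real.sqrt (2 / 3) ≤ s)
    (hs' : s < ((k : ℝ) + 1) * Real.sqrt (2 / 3)) {Q : Finset (EuclideanSpace ℝ (Fin 3))}
    (hlev : ∀ q ∈ Q, q 2 = ((k : ℝ) + 1) * Real.sqrt (2 / 3) ∨ q 2 = ((k : ℝ) + 2) * Real.sqrt (2 / 3)) :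
    ¬ IsCriminal (EuclideanSpace.single 2 (1 : ℝ)) s Q := by
  set c : ℝ := Real.sqrt (2 / 3) with hc
  have hcpos : 0 < c := Real.sqrt_pos.2 (by norm_num)
  set g : ℝ → ℝ := fun z => min 2 (max 0 (1 - z / c)) with hg
  have hclip : ∀ t : ℝ, min 2 (max 0 (1 - t)) + min 2 (max 0 (1 + t)) = 2 := by
    intro t
    simp only [min_def, max_def]
    split_ifs <;> linarith
  have hsym : ∀ z, g z + g (-z) = 2 := by
    intro z
    have h := hclip (z / c)
    simp only [hg, neg_div]
    rwa [sub_neg_eq_add]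
  have hplug : ∀ z, z ≤ -c → g z = 2 := by
    intro z hz
    have : 2 ≤ 1 - z / c := by
      have : z / c ≤ -1 := by rw [div_le_iff₀ hcpos]; linarith
      linarith
    simp only [hg]
    rw [max_eq_right (by linarith), min_eq_left this]
  refine not_isCriminal_basal_of_rows k hs hs' hsym hplug fun q hq N hN1 hN2 hN3 => ?_
  apply levelRow_ramp N hN1 hN2
  intro u hu
  rcases hN3 u hu with h | ⟨x, hx, h⟩
  · rcases hlev q hq with hq' | hq'
    · right; left; rw [h, hq']; ring
    · left; rw [h, hq']; ring
  · rcases hlev q hq with hq' | hq' <;> rcases hlev x hx with hx' | hx'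
    · right; right; left; rw [h, hq', hx']; ring
    · right; right; right; rw [h, hq', hx']; ring
    · right; left; rw [h, hq', hx']; ring
    · right; right; left; rw [h, hq', hx']; ring

end Summit.Ventures.Crystal3D.Theorems

end
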